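import Literature.Probability.LatticeModels.TorusGreenHessianDecay
import HarnessLib

/-!
# Crux `SelfNormalisedSkewness` (stmt-QuantumFields-18944), line `Sketch`, stub `stub_torusGreenThirdDiff`:
# Hessians of products of coordinate kernels

Helpers for the stub `stub_torusGreenThirdDiff` (third differences of the four-torus Green function).
The third difference `∇ₖ⁻∇ᵢ⁺∇ⱼ⁻[∏_μ q(·_μ)](z)` of a product kernel is the Hessian `∇ᵢ⁺∇ⱼ⁻` of the
product of the COORDINATE kernels `Q_μ = q` (`μ ≠ k`), `Q_k = ∇⁻q` (`thirdDiff_prod_eq`, lattice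
differences commute); the Hessian of such a product is a product of one-dimensional (differences of)
kernels (`hessian_prodKernel_of_ne`, `hessian_prodKernel_of_eq`, as in `TorusGreenHessianDecay`), and
one-dimensional bounds with amplitudes `a_μ`, a scale `σ` and a Gaussian weight `W ≤ 1` give
`|∇ᵢ⁺∇ⱼ⁻ ∏ Q| ≤ (∏ a_μ) σ⁶ W(z_{μ₀})` in `d = 4` (`abs_hessian_prodKernel_le`). Also here: the
second difference of the torus heat kernel based at `m - 1` with the Gaussian weight at `m`
(`abs_torusHeatKernel_sndDiff_shift_le`), the bound needed for `∇⁻Q_k = ∇⁻∇⁻q`.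

No named facts are used.
-/

noncomputable section

open MeasureTheory Set Filter Finset ZMod
open scoped Real Topology BigOperators
open Literature.Probability.LatticeModels

namespace Summit.QuantumFields.YangMills.Theorems.SelfNormalisedSkewness.Negative

variable {d L : ℕ}

/-! ### The shifted second difference -/

/-- **Decay of the shifted second difference**: for every `p : ℕ` there is `A > 0` with
`|q_t(n) - 2q_t(n-1) + q_t(n-2)| ≤ A (1 ∨ t)⁻¹ (1 ∨ t)^{-1/2} (1 + n²/(1 ∨ t))^{-p}` for all `t > 0`,
`n ∈ ℤ` (the second difference at `n - 1`, and `1 + n²/T ≤ 3 (1 + (n-1)²/T)` for `T ≥ 1`).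
[folklore] -/
theorem srwHeatKernel_sndDiff_shift_decay (p : ℕ) : ∃ A : ℝ, 0 < A ∧ ∀ t : ℝ, 0 < t → ∀ n : ℤ,
    |srwHeatKernel t n - 2 * srwHeatKernel t (n - 1) + srwHeatKernel t (n - 2)| ≤
      A * ((max 1 t)⁻¹ * (max 1 t) ^ (-(1 / 2 : ℝ))) * ((1 + (n : ℝ) ^ 2 / max 1 t) ^ p)⁻¹ := by
  obtain ⟨A, hA, h⟩ := srwHeatKernel_sndDiff_decay p
  refine ⟨A * 3 ^ p, by positivity, fun t ht n => ?_⟩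
  have h1 := h t ht (n - 1)
  rw [sub_add_cancel, show (n - 1 - 1 : ℤ) = n - 2 by ring, Int.cast_sub, Int.cast_one] at h1
  set T : ℝ := max 1 t with hT
  have hT1 : 1 ≤ T := le_max_left _ _
  have hT0 : 0 < T := by positivity
  have key : 1 + (n : ℝ) ^ 2 / T ≤ 3 * (1 + ((n : ℝ) - 1) ^ 2 / T) := by
    have h2 : (n : ℝ) ^ 2 ≤ 2 * ((n : ℝ) - 1) ^ 2 + 2 := by nlinarith [sq_nonneg ((n : ℝ) - 2)]
    have h3 : (n : ℝ) ^ 2 / T ≤ (2 * ((n : ℝ) - 1) ^ 2 + 2) / T :=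
      div_le_div_of_nonneg_right h2 hT0.le
    have h4 : (2 * ((n : ℝ) - 1) ^ 2 + 2) / T = 2 * (((n : ℝ) - 1) ^ 2 / T) + 2 / T := by ring
    have h5 : 2 / T ≤ 2 := div_le_self (by norm_num) hT1
    have h6 : 0 ≤ ((n : ℝ) - 1) ^ 2 / T := by positivity
    linarith
  have hw : ((1 + ((n : ℝ) - 1) ^ 2 / T) ^ p)⁻¹ ≤ 3 ^ p * ((1 + (n : ℝ) ^ 2 / T) ^ p)⁻¹ := by
    calc ((1 + ((n : ℝ) - 1) ^ 2 / T) ^ p)⁻¹ = 3 ^ p * ((3 * (1 + ((n : ℝ) - 1) ^ 2 / T)) ^ p)⁻¹ := by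
          rw [mul_pow, mul_inv, ← mul_assoc, mul_inv_cancel₀ (by positivity), one_mul]
      _ ≤ 3 ^ p * ((1 + (n : ℝ) ^ 2 / T) ^ p)⁻¹ :=
          mul_le_mul_of_nonneg_left (inv_anti₀ (by positivity) (pow_le_pow_left₀ (by positivity)
            key p)) (by positivity)
  calc _ ≤ A * (T⁻¹ * T ^ (-(1 / 2 : ℝ))) * ((1 + ((n : ℝ) - 1) ^ 2 / T) ^ p)⁻¹ := h1
    _ ≤ A * (T⁻¹ * T ^ (-(1 / 2 : ℝ))) * (3 ^ p * ((1 + (n : ℝ) ^ 2 / T) ^ p)⁻¹) := by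
        gcongr
    _ = A * 3 ^ p * (T⁻¹ * T ^ (-(1 / 2 : ℝ))) * ((1 + (n : ℝ) ^ 2 / T) ^ p)⁻¹ := by ring


/-- **Shifted second difference of the torus heat kernel**: there is `K > 0` such that for all
`L ≥ 1`, `0 < t ≤ L²` and `m ∈ ℤ/Lℤ`,
`|q^L_t(m) - 2q^L_t(m-1) + q^L_t(m-2)| ≤ K (1∨t)⁻¹(1∨t)^{-1/2} (1 + m̃²/(1∨t))⁻³` (`m̃ = valMinAbs m`).
[folklore] -/
theorem abs_torusHeatKernel_sndDiff_shift_le : ∃ K : ℝ, 0 < K ∧ ∀ (L : ℕ) [NeZero L] (t : ℝ),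
    0 < t → t ≤ (L : ℝ) ^ 2 → ∀ m : ZMod L,
      |torusHeatKernel t m - 2 * torusHeatKernel t (m - 1) + torusHeatKernel t (m - 2)| ≤
      K * ((max 1 t)⁻¹ * (max 1 t) ^ (-(1 / 2 : ℝ))) *
        ((1 + (m.valMinAbs : ℝ) ^ 2 / max 1 t) ^ 3)⁻¹ := by
  obtain ⟨A, hA, hq⟩ := srwHeatKernel_sndDiff_shift_decay 4
  have hS := one_le_tsum_inv_one_add_sq_div_four
  refine ⟨A * ∑' w : ℤ, (1 + (w : ℝ) ^ 2 / 4)⁻¹, by positivity, ?_⟩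
  intro L _ t ht htL m
  obtain ⟨hs0, hrep0⟩ := torusHeatKernel_eq_tsum (L := L) ht m.valMinAbs
  obtain ⟨hs1, hrep1⟩ := torusHeatKernel_eq_tsum (L := L) ht (m.valMinAbs - 1)
  obtain ⟨hs2, hrep2⟩ := torusHeatKernel_eq_tsum (L := L) ht (m.valMinAbs - 2)
  rw [ZMod.coe_valMinAbs] at hrep0
  rw [Int.cast_sub, Int.cast_one, ZMod.coe_valMinAbs] at hrep1
  rw [Int.cast_sub, Int.cast_ofNat, ZMod.coe_valMinAbs] at hrep2
  rw [hrep0, hrep1, hrep2, ← tsum_mul_left (a := 2), ← hs0.tsum_sub (hs1.mul_left 2),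
    ← (hs0.sub (hs1.mul_left 2)).tsum_add hs2]
  have e : ∀ w : ℤ, srwHeatKernel t (m.valMinAbs + w * L) -
      2 * srwHeatKernel t (m.valMinAbs - 1 + w * L) + srwHeatKernel t (m.valMinAbs - 2 + w * L) =
      srwHeatKernel t (m.valMinAbs + w * L) - 2 * srwHeatKernel t (m.valMinAbs + w * L - 1) +
        srwHeatKernel t (m.valMinAbs + w * L - 2) := fun w => by
    rw [show m.valMinAbs - 1 + w * L = m.valMinAbs + w * L - 1 by ring,
      show m.valMinAbs - 2 + w * L = m.valMinAbs + w * L - 2 by ring]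
  simp_rw [e]
  have h := (abs_tsum_periodize_le
    (f := fun n => srwHeatKernel t n - 2 * srwHeatKernel t (n - 1) + srwHeatKernel t (n - 2))
    (B := A * ((max 1 t)⁻¹ * (max 1 t) ^ (-(1 / 2 : ℝ)))) (by positivity) htL
    (fun n => hq t ht n) m).2
  calc _ ≤ _ := h
    _ = _ := by ring

/-! ### The Hessian of a product of coordinate kernels -/

/-- Splitting a product over `Fin d` at two distinct indices. [folklore] -/
private theorem prod_eq_mul_mul_prod_erase_erase' {i j : Fin d} (hij : i ≠ j) (f : Fin d → ℝ) :
    ∏ μ, f μ = f i * f j * ∏ μ ∈ ((univ : Finset (Fin d)).erase i).erase j, f μ := by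
  rw [mul_assoc, Finset.mul_prod_erase _ _ (Finset.mem_erase.2 ⟨hij.symm, Finset.mem_univ j⟩),
    Finset.mul_prod_erase _ _ (Finset.mem_univ i)]

/-- **Mixed second difference of a product of coordinate kernels, `i ≠ j`**:
`∇ᵢ⁺∇ⱼ⁻[∏_μ Q_μ(·_μ)](z) = (Q_i(zᵢ+1) - Q_i(zᵢ)) (Q_j(zⱼ) - Q_j(zⱼ-1)) ∏_{μ ≠ i,j} Q_μ(z_μ)`. [folklore] -/
theorem hessian_prodKernel_of_ne (Q : Fin d → ZMod L → ℝ) (z : TorusSite d L) {i j : Fin d}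
    (hij : i ≠ j) :
    (∏ μ, Q μ ((z + Pi.single i 1 : TorusSite d L) μ)) -
        (∏ μ, Q μ ((z + Pi.single i 1 - Pi.single j 1 : TorusSite d L) μ)) -
        (∏ μ, Q μ (z μ)) + ∏ μ, Q μ ((z - Pi.single j 1 : TorusSite d L) μ) =
      (Q i (z i + 1) - Q i (z i)) * (Q j (z j) - Q j (z j - 1)) *
        ∏ μ ∈ ((univ : Finset (Fin d)).erase i).erase j, Q μ (z μ) := by
  set zA : TorusSite d L := z + Pi.single i 1 with hzA
  set zB : TorusSite d L := z + Pi.single i 1 - Pi.single j 1 with hzB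
  set zD : TorusSite d L := z - Pi.single j 1 with hzD
  have hE : ∀ μ ∈ ((univ : Finset (Fin d)).erase i).erase j, μ ≠ i ∧ μ ≠ j := fun μ hμ =>
    ⟨Finset.ne_of_mem_erase (Finset.mem_of_mem_erase hμ), Finset.ne_of_mem_erase hμ⟩
  have hAi : zA i = z i + 1 := by simp [hzA]
  have hAj : zA j = z j := by simp [hzA, Pi.single_eq_of_ne hij.symm]
  have hBi : zB i = z i + 1 := by simp [hzB, Pi.single_eq_of_ne hij]
  have hBj : zB j = z j - 1 := by simp [hzB, Pi.single_eq_of_ne hij.symm]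
  have hDi : zD i = z i := by simp [hzD, Pi.single_eq_of_ne hij]
  have hDj : zD j = z j - 1 := by simp [hzD]
  have hA : ∏ μ ∈ ((univ : Finset (Fin d)).erase i).erase j, Q μ (zA μ) =
      ∏ μ ∈ ((univ : Finset (Fin d)).erase i).erase j, Q μ (z μ) :=
    Finset.prod_congr rfl fun μ hμ => by
      simp [hzA, Pi.single_eq_of_ne (hE μ hμ).1]
  have hB : ∏ μ ∈ ((univ : Finset (Fin d)).erase i).erase j, Q μ (zB μ) =
      ∏ μ ∈ ((univ : Finset (Fin d)).erase i).erase j, Q μ (z μ) :=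
    Finset.prod_congr rfl fun μ hμ => by
      simp [hzB, Pi.single_eq_of_ne (hE μ hμ).1, Pi.single_eq_of_ne (hE μ hμ).2]
  have hD : ∏ μ ∈ ((univ : Finset (Fin d)).erase i).erase j, Q μ (zD μ) =
      ∏ μ ∈ ((univ : Finset (Fin d)).erase i).erase j, Q μ (z μ) :=
    Finset.prod_congr rfl fun μ hμ => by
      simp [hzD, Pi.single_eq_of_ne (hE μ hμ).2]
  rw [prod_eq_mul_mul_prod_erase_erase' hij (fun μ => Q μ (zA μ)),
    prod_eq_mul_mul_prod_erase_erase' hij (fun μ => Q μ (zB μ)),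
    prod_eq_mul_mul_prod_erase_erase' hij (fun μ => Q μ (z μ)),
    prod_eq_mul_mul_prod_erase_erase' hij (fun μ => Q μ (zD μ)), hA, hB, hD, hAi, hAj, hBi, hBj,
    hDi, hDj]
  ring

/-- **Second difference of a product of coordinate kernels, `i = j`**:
`∇ᵢ⁺∇ᵢ⁻[∏_μ Q_μ(·_μ)](z) = (Q_i(zᵢ+1) - 2Q_i(zᵢ) + Q_i(zᵢ-1)) ∏_{μ ≠ i} Q_μ(z_μ)`. [folklore] -/
theorem hessian_prodKernel_of_eq (Q : Fin d → ZMod L → ℝ) (z : TorusSite d L) (i : Fin d) :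
    (∏ μ, Q μ ((z + Pi.single i 1 : TorusSite d L) μ)) -
        (∏ μ, Q μ ((z + Pi.single i 1 - Pi.single i 1 : TorusSite d L) μ)) -
        (∏ μ, Q μ (z μ)) + ∏ μ, Q μ ((z - Pi.single i 1 : TorusSite d L) μ) =
      (Q i (z i + 1) - 2 * Q i (z i) + Q i (z i - 1)) *
        ∏ μ ∈ (univ : Finset (Fin d)).erase i, Q μ (z μ) := by
  rw [add_sub_cancel_right]
  set zA : TorusSite d L := z + Pi.single i 1 with hzA
  set zD : TorusSite d L := z - Pi.single i 1 with hzD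
  have hE : ∀ μ ∈ (univ : Finset (Fin d)).erase i, μ ≠ i := fun μ hμ => Finset.ne_of_mem_erase hμ
  have hAi : zA i = z i + 1 := by simp [hzA]
  have hDi : zD i = z i - 1 := by simp [hzD]
  have hA : ∏ μ ∈ (univ : Finset (Fin d)).erase i, Q μ (zA μ) =
      ∏ μ ∈ (univ : Finset (Fin d)).erase i, Q μ (z μ) :=
    Finset.prod_congr rfl fun μ hμ => by simp [hzA, Pi.single_eq_of_ne (hE μ hμ)]
  have hD : ∏ μ ∈ (univ : Finset (Fin d)).erase i, Q μ (zD μ) =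
      ∏ μ ∈ (univ : Finset (Fin d)).erase i, Q μ (z μ) :=
    Finset.prod_congr rfl fun μ hμ => by simp [hzD, Pi.single_eq_of_ne (hE μ hμ)]
  rw [← Finset.mul_prod_erase _ (fun μ => Q μ (zA μ)) (Finset.mem_univ i),
    ← Finset.mul_prod_erase _ (fun μ => Q μ (z μ)) (Finset.mem_univ i),
    ← Finset.mul_prod_erase _ (fun μ => Q μ (zD μ)) (Finset.mem_univ i), hA, hD, hAi, hDi]
  ring

/-- **Backward difference of a product kernel as a product of coordinate kernels**: if
`Q_k = ∇⁻q = q(·) - q(· - 1)` and `Q_μ = q` for `μ ≠ k`, then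
`∏_μ Q_μ(y_μ) = ∏_μ q(y_μ) - ∏_μ q((y - e_k)_μ)`. [folklore] -/
theorem prod_coordKernel_eq_bwdDiff (q : ZMod L → ℝ) (Q : Fin d → ZMod L → ℝ) (k : Fin d)
    (hQk : ∀ m, Q k m = q m - q (m - 1)) (hQ : ∀ μ, μ ≠ k → ∀ m, Q μ m = q m)
    (y : TorusSite d L) :
    ∏ μ, Q μ (y μ) = (∏ μ, q (y μ)) - ∏ μ, q ((y - Pi.single k 1 : TorusSite d L) μ) := by
  set yK : TorusSite d L := y - Pi.single k 1 with hyK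
  have hE : ∀ μ ∈ (univ : Finset (Fin d)).erase k, μ ≠ k := fun μ hμ => Finset.ne_of_mem_erase hμ
  have h1 : ∏ μ ∈ (univ : Finset (Fin d)).erase k, Q μ (y μ) =
      ∏ μ ∈ (univ : Finset (Fin d)).erase k, q (y μ) :=
    Finset.prod_congr rfl fun μ hμ => hQ μ (hE μ hμ) _
  have h2 : ∏ μ ∈ (univ : Finset (Fin d)).erase k, q (yK μ) =
      ∏ μ ∈ (univ : Finset (Fin d)).erase k, q (y μ) :=
    Finset.prod_congr rfl fun μ hμ => by simp [hyK, Pi.single_eq_of_ne (hE μ hμ)]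
  have hk : yK k = y k - 1 := by simp [hyK]
  rw [← Finset.mul_prod_erase _ (fun μ => Q μ (y μ)) (Finset.mem_univ k),
    ← Finset.mul_prod_erase _ (fun μ => q (y μ)) (Finset.mem_univ k),
    ← Finset.mul_prod_erase _ (fun μ => q (yK μ)) (Finset.mem_univ k), h1, h2, hk, hQk]
  ring

/-- **The third difference of a product kernel is the Hessian of its backward difference**:
`∇ᵢ⁺∇ⱼ⁻[∏ q](z) - ∇ᵢ⁺∇ⱼ⁻[∏ q](z - e_k) = ∇ᵢ⁺∇ⱼ⁻[∏_μ Q_μ(·_μ)](z)` with `Q` as in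
`prod_coordKernel_eq_bwdDiff` (lattice differences commute). [folklore] -/
theorem thirdDiff_prod_eq (q : ZMod L → ℝ) (Q : Fin d → ZMod L → ℝ) (k : Fin d)
    (hQk : ∀ m, Q k m = q m - q (m - 1)) (hQ : ∀ μ, μ ≠ k → ∀ m, Q μ m = q m)
    (z : TorusSite d L) (i j : Fin d) :
    ((∏ μ, q ((z + Pi.single i 1 : TorusSite d L) μ)) -
        (∏ μ, q ((z + Pi.single i 1 - Pi.single j 1 : TorusSite d L) μ)) -
        (∏ μ, q (z μ)) + ∏ μ, q ((z - Pi.single j 1 : TorusSite d L) μ)) -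
      ((∏ μ, q ((z - Pi.single k 1 + Pi.single i 1 : TorusSite d L) μ)) -
        (∏ μ, q ((z - Pi.single k 1 + Pi.single i 1 - Pi.single j 1 : TorusSite d L) μ)) -
        (∏ μ, q ((z - Pi.single k 1 : TorusSite d L) μ)) +
        ∏ μ, q ((z - Pi.single k 1 - Pi.single j 1 : TorusSite d L) μ)) =
    (∏ μ, Q μ ((z + Pi.single i 1 : TorusSite d L) μ)) -
        (∏ μ, Q μ ((z + Pi.single i 1 - Pi.single j 1 : TorusSite d L) μ)) -
        (∏ μ, Q μ (z μ)) + ∏ μ, Q μ ((z - Pi.single j 1 : TorusSite d L) μ) := by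
  have hP := prod_coordKernel_eq_bwdDiff q Q k hQk hQ
  rw [hP, hP, hP, hP]
  have e1 : (z + Pi.single i 1 - Pi.single k 1 : TorusSite d L) =
      z - Pi.single k 1 + Pi.single i 1 := by abel
  have e2 : (z + Pi.single i 1 - Pi.single j 1 - Pi.single k 1 : TorusSite d L) =
      z - Pi.single k 1 + Pi.single i 1 - Pi.single j 1 := by abel
  have e3 : (z - Pi.single j 1 - Pi.single k 1 : TorusSite d L) =
      z - Pi.single k 1 - Pi.single j 1 := by abel
  rw [e1, e2, e3]
  ring

/-- A product of numbers in `[0, 1]` is at most any one of its factors. [folklore] -/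
private theorem prod_le_apply_of_le_one' {W : Fin d → ℝ} (h0 : ∀ μ, 0 ≤ W μ) (h1 : ∀ μ, W μ ≤ 1)
    (μ₀ : Fin d) : ∏ μ, W μ ≤ W μ₀ := by
  rw [← Finset.mul_prod_erase _ _ (Finset.mem_univ μ₀)]
  exact mul_le_of_le_one_right (h0 μ₀) (Finset.prod_le_one (fun μ _ => h0 μ) fun μ _ => h1 μ)

/-- **Hessian of a product of coordinate kernels in `d = 4` under one-dimensional bounds.** If every
coordinate kernel `Q_μ` satisfies `|Q_μ| ≤ a_μ σ W`, `|∇^±Q_μ| ≤ a_μ σ² W`, `|∇⁺∇⁻Q_μ| ≤ a_μ σ³ W`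
with a weight `0 ≤ W ≤ 1` (evaluated at the base point), then for every coordinate `μ₀`,
`|∇ᵢ⁺∇ⱼ⁻[∏_μ Q_μ(·_μ)](z)| ≤ (∏_μ a_μ) σ⁶ W(z_{μ₀})`: two differences fall on one or two
coordinates, and all weights but the one at `μ₀` are discarded. [folklore] -/
theorem abs_hessian_prodKernel_le (Q : Fin 4 → ZMod L → ℝ) (a : Fin 4 → ℝ) (σ : ℝ)
    (W : ZMod L → ℝ) (ha : ∀ μ, 0 ≤ a μ) (hσ : 0 ≤ σ) (hW0 : ∀ m, 0 ≤ W m) (hW1 : ∀ m, W m ≤ 1)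
    (h0 : ∀ μ m, |Q μ m| ≤ a μ * σ * W m)
    (h1 : ∀ μ m, |Q μ (m + 1) - Q μ m| ≤ a μ * σ ^ 2 * W m)
    (h2 : ∀ μ m, |Q μ m - Q μ (m - 1)| ≤ a μ * σ ^ 2 * W m)
    (h3 : ∀ μ m, |Q μ (m + 1) - 2 * Q μ m + Q μ (m - 1)| ≤ a μ * σ ^ 3 * W m)
    (z : TorusSite 4 L) (i j μ₀ : Fin 4) :
    |(∏ μ, Q μ ((z + Pi.single i 1 : TorusSite 4 L) μ)) -
        (∏ μ, Q μ ((z + Pi.single i 1 - Pi.single j 1 : TorusSite 4 L) μ)) -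
        (∏ μ, Q μ (z μ)) + ∏ μ, Q μ ((z - Pi.single j 1 : TorusSite 4 L) μ)| ≤
      (∏ μ, a μ) * σ ^ 6 * W (z μ₀) := by
  have hWμ₀ : ∏ μ, W (z μ) ≤ W (z μ₀) :=
    prod_le_apply_of_le_one' (W := fun μ => W (z μ)) (fun μ => hW0 _) (fun μ => hW1 _) μ₀
  have hpa : 0 ≤ ∏ μ, a μ := Finset.prod_nonneg fun μ _ => ha μ
  rcases eq_or_ne i j with rfl | hij
  · rw [hessian_prodKernel_of_eq Q z i, abs_mul, Finset.abs_prod]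
    have hcard : ((univ : Finset (Fin 4)).erase i).card = 3 := by
      rw [Finset.card_erase_of_mem (Finset.mem_univ i), Finset.card_univ, Fintype.card_fin]
    have hrest : ∏ μ ∈ (univ : Finset (Fin 4)).erase i, |Q μ (z μ)| ≤
        ∏ μ ∈ (univ : Finset (Fin 4)).erase i, (a μ * σ * W (z μ)) :=
      Finset.prod_le_prod (fun μ _ => abs_nonneg _) fun μ _ => h0 μ (z μ)
    have hai := ha i
    have hWi := hW0 (z i)
    calc |Q i (z i + 1) - 2 * Q i (z i) + Q i (z i - 1)| *
          ∏ μ ∈ (univ : Finset (Fin 4)).erase i, |Q μ (z μ)|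
        ≤ (a i * σ ^ 3 * W (z i)) * ∏ μ ∈ (univ : Finset (Fin 4)).erase i, (a μ * σ * W (z μ)) :=
          mul_le_mul (h3 i (z i)) hrest (Finset.prod_nonneg fun μ _ => abs_nonneg _)
            (by positivity)
      _ = (a i * ∏ μ ∈ (univ : Finset (Fin 4)).erase i, a μ) * σ ^ 6 *
            (W (z i) * ∏ μ ∈ (univ : Finset (Fin 4)).erase i, W (z μ)) := by
          rw [Finset.prod_mul_distrib, Finset.prod_mul_distrib, Finset.prod_const, hcard]
          ring
      _ = (∏ μ, a μ) * σ ^ 6 * ∏ μ, W (z μ) := by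
          rw [Finset.mul_prod_erase _ a (Finset.mem_univ i),
            Finset.mul_prod_erase _ (fun μ => W (z μ)) (Finset.mem_univ i)]
      _ ≤ (∏ μ, a μ) * σ ^ 6 * W (z μ₀) := by gcongr
  · rw [hessian_prodKernel_of_ne Q z hij, abs_mul, abs_mul, Finset.abs_prod]
    have hcard : (((univ : Finset (Fin 4)).erase i).erase j).card = 2 := by
      rw [Finset.card_erase_of_mem (Finset.mem_erase.2 ⟨hij.symm, Finset.mem_univ j⟩),
        Finset.card_erase_of_mem (Finset.mem_univ i), Finset.card_univ, Fintype.card_fin]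
    have hrest : ∏ μ ∈ ((univ : Finset (Fin 4)).erase i).erase j, |Q μ (z μ)| ≤
        ∏ μ ∈ ((univ : Finset (Fin 4)).erase i).erase j, (a μ * σ * W (z μ)) :=
      Finset.prod_le_prod (fun μ _ => abs_nonneg _) fun μ _ => h0 μ (z μ)
    have hai := ha i
    have hWi := hW0 (z i)
    have haj := ha j
    have hWj := hW0 (z j)
    calc |Q i (z i + 1) - Q i (z i)| * |Q j (z j) - Q j (z j - 1)| *
          ∏ μ ∈ ((univ : Finset (Fin 4)).erase i).erase j, |Q μ (z μ)|
        ≤ (a i * σ ^ 2 * W (z i)) * (a j * σ ^ 2 * W (z j)) *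
            ∏ μ ∈ ((univ : Finset (Fin 4)).erase i).erase j, (a μ * σ * W (z μ)) :=
          mul_le_mul (mul_le_mul (h1 i (z i)) (h2 j (z j)) (abs_nonneg _) (by positivity)) hrest
            (Finset.prod_nonneg fun μ _ => abs_nonneg _) (by positivity)
      _ = (a i * a j * ∏ μ ∈ ((univ : Finset (Fin 4)).erase i).erase j, a μ) * σ ^ 6 *
            (W (z i) * W (z j) * ∏ μ ∈ ((univ : Finset (Fin 4)).erase i).erase j, W (z μ)) := by
          rw [Finset.prod_mul_distrib, Finset.prod_mul_distrib, Finset.prod_const, hcard]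
          ring
      _ = (∏ μ, a μ) * σ ^ 6 * ∏ μ, W (z μ) := by
          rw [← prod_eq_mul_mul_prod_erase_erase' hij a,
            ← prod_eq_mul_mul_prod_erase_erase' hij (fun μ => W (z μ))]
      _ ≤ (∏ μ, a μ) * σ ^ 6 * W (z μ₀) := by gcongr

end Summit.QuantumFields.YangMills.Theorems.SelfNormalisedSkewness.Negative
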